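import Summits.CriticalPhenomena.PercolationContinuityZ3.Theorems.PercNearOneGluingNoHeavyLowerTailSwitchRelaxCheckNSound
import HarnessLib

/-!
# `NoHeavyLowerTail` (stmt-CriticalPhenomena-4575) — the FINITE RELAXATION of three-copy switching certificates, III b:
# the CUBIC IDENTITY of a certificate checked reflectively (no `ring` on thousand-term polynomials)

Support file (prover prim-cert-2 gen 12; `--supports stmt-CriticalPhenomena-4575`).  No named facts, no sorries.

A switching certificate for `E₃(A, B, C) ≥ 0` comes with the polynomial identity
`Σ λ₀(r,s,t) P_r P_s P_t + σ · Σ_p Σ λ_p(s,t) P_s P_t + D · E₃ʰᵒᵐ(P) ≡ 0` in the 15 type masses (`σ = Σ P`, `E₃ʰᵒᵐ` the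
homogenised Sahi functional of the three events given as cell lists).  Part III's measure files proved it by `ring` on the
written-out polynomial; for certificates with ≳ 10³ entries (prim-masterthm-p1's K3 rows: 500–1 450 entries in `λ₀`) that
does not scale.  Here the identity is checked by the KERNEL on the integer tables: `cubicCheck` symmetrises the coefficient
function of the left-hand side over the six orderings of `(r,s,t)` and tests that every symmetrised coefficient vanishes
(3 375 small table computations), and `cubic_sound` turns `cubicCheck = true`, `Σ P = 1` and `ES c P ≤ 0` (part III's
`ES_nonpos_of_check` / part IId's `ES_nonpos_of_Sreal`) into `0 ≤ 2·S(ABC) + S(A)S(B)S(C) − (S(A)S(BC) + S(B)S(AC) + S(C)S(AB))`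
with `S(L) = Σ_{i ∈ L} P_i` — the cell-level `E₃ ≥ 0` that the dictionary of a measure file turns into `sahiE3 ≥ 0`.
-/

namespace Summit.CriticalPhenomena.PercolationContinuityZ3.Theorems

namespace SwitchRelax

open Finset FourPointAtoms
open scoped BigOperators

/-! ### Cell lists and coefficient functions -/

/-- Sum of the masses over a list of cell indices. [this work] -/
noncomputable def S (L : List ℕ) (P : Ty → ℝ) : ℝ := (L.map fun i => P (tyOf i)).sum

/-- `S` on a cons. [this work] -/
theorem S_cons (i : ℕ) (L : List ℕ) (P : Ty → ℝ) : S (i :: L) P = P (tyOf i) + S L P := by simp [S]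
/-- `S` on nil. [this work] -/
theorem S_nil (P : Ty → ℝ) : S [] P = 0 := by simp [S]

/-- Integer indicator of a cell-index list. [this work] -/
def ind (L : List ℕ) (i : Ty) : ℤ := if i.val ∈ L then 1 else 0

/-- Coefficient function of the homogenised `E₃` (first slot `r`, then `s`, `t`). [this work] -/
def e3C (A B C AB AC BC ABC : List ℕ) (r s t : Ty) : ℤ :=
  2 * ind ABC r + ind A r * ind B s * ind C t - ind A r * ind BC s - ind B r * ind AC s - ind C r * ind AB s

/-- `Σ_p λ_p(s,t)` read from the tabulated program potentials. [this work] -/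
def lpC (TP : List (List (List ℤ))) (s t : Ty) : ℤ := (TP.map fun T => get2 T s.val t.val).sum

/-- Symmetrisation of a coefficient function over the six orderings. [folklore] -/
def symC (F : Ty → Ty → Ty → ℤ) (r s t : Ty) : ℤ := F r s t + F r t s + F s r t + F s t r + F t r s + F t s r

/-- A cell list is admissible: indices `< 15`, no repetitions. [this work] -/
def listOK (L : List ℕ) : Bool := L.all (fun i => decide (i < 15)) && decide L.Nodup

/-- The coefficient function of a certificate's identity, from its tables. [this work] -/
def coefZ (T03 : List (List (List ℤ))) (TP : List (List (List ℤ))) (D : ℤ) (A B C AB AC BC ABC : List ℕ) (r s t : Ty) : ℤ :=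
  get2 (getN T03 r.val []) s.val t.val + lpC TP s t + D * e3C A B C AB AC BC ABC r s t

/-- **THE CUBIC CHECK**: all symmetrised coefficients of `λ₀ + σ·Σλ_p + D·E₃ʰᵒᵐ` vanish, the cell lists are admissible,
and `D > 0`. [this work] -/
def cubicCheck (T03 : List (List (List ℤ))) (TP : List (List (List ℤ))) (D : ℤ) (A B C AB AC BC ABC : List ℕ) : Bool :=
  decide (0 < D) && listOK A && listOK B && listOK C && listOK AB && listOK AC && listOK BC && listOK ABC &&
  allTys.all fun r => allTys.all fun s => allTys.all fun t => symC (coefZ T03 TP D A B C AB AC BC ABC) r s t == 0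

/-! ### Symmetric triple sums -/

section Sums

variable (P : Ty → ℝ)

/-- The cubic form of a real coefficient function. [this work] -/
noncomputable def form (F : Ty → Ty → Ty → ℝ) : ℝ := ∑ r, ∑ s, ∑ t, F r s t * (P r * P s * P t)

/-- Additivity. [folklore] -/
theorem form_add (F G : Ty → Ty → Ty → ℝ) : form P (fun r s t => F r s t + G r s t) = form P F + form P G := by
  simp only [form, add_mul, Finset.sum_add_distrib]

/-- Subtraction. [folklore] -/
theorem form_sub (F G : Ty → Ty → Ty → ℝ) : form P (fun r s t => F r s t - G r s t) = form P F - form P G := by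
  simp only [form, sub_mul, Finset.sum_sub_distrib]

/-- Scalars. [folklore] -/
theorem form_smul (a : ℝ) (F : Ty → Ty → Ty → ℝ) : form P (fun r s t => a * F r s t) = a * form P F := by
  simp only [form, mul_assoc, Finset.mul_sum]

/-- Swapping the last two slots. [folklore] -/
theorem form_swap23 (F : Ty → Ty → Ty → ℝ) : form P (fun r s t => F r t s) = form P F := by
  unfold form
  refine Finset.sum_congr rfl fun r _ => ?_
  rw [Finset.sum_comm]
  exact Finset.sum_congr rfl fun s _ => Finset.sum_congr rfl fun t _ => by ring

/-- Swapping the first two slots. [folklore] -/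
theorem form_swap12 (F : Ty → Ty → Ty → ℝ) : form P (fun r s t => F s r t) = form P F := by
  unfold form
  rw [Finset.sum_comm]
  exact Finset.sum_congr rfl fun r _ => Finset.sum_congr rfl fun s _ => Finset.sum_congr rfl fun t _ => by ring

/-- **A coefficient function with vanishing symmetrisation has vanishing form.** [this work] -/
theorem form_eq_zero_of_symC (F : Ty → Ty → Ty → ℤ) (h : ∀ r s t, symC F r s t = 0) :
    form P (fun r s t => (F r s t : ℝ)) = 0 := by
  set G : Ty → Ty → Ty → ℝ := fun r s t => (F r s t : ℝ) with hG
  have h2 : form P (fun r s t => G r t s) = form P G := form_swap23 P G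
  have h3 : form P (fun r s t => G s r t) = form P G := form_swap12 P G
  have h4 : form P (fun r s t => G s t r) = form P G :=
    (form_swap12 P (fun r s t => G r t s)).trans h2
  have h5 : form P (fun r s t => G t r s) = form P G :=
    (form_swap23 P (fun r s t => G s r t)).trans h3
  have h6 : form P (fun r s t => G t s r) = form P G :=
    (form_swap23 P (fun r s t => G s t r)).trans h4
  have hsum : form P (fun r s t => G r s t + G r t s + G s r t + G s t r + G t r s + G t s r) = 6 * form P G := by
    rw [form_add, form_add, form_add, form_add, form_add, h2, h3, h4, h5, h6]; unfold form; ring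
  have h0 : form P (fun r s t => G r s t + G r t s + G s r t + G s t r + G t r s + G t s r) = 0 := by
    unfold form
    refine Finset.sum_eq_zero fun r _ => Finset.sum_eq_zero fun s _ => Finset.sum_eq_zero fun t _ => ?_
    have h1 := h r s t
    simp only [symC] at h1
    have h' : (F r s t : ℝ) + F r t s + F s r t + F s t r + F t r s + F t s r = 0 := by exact_mod_cast h1
    simp only [hG, h', zero_mul]
  have : 6 * form P G = 0 := hsum ▸ h0
  linarith

/-- Product coefficient functions factor. [folklore] -/
theorem form_prod (u v w : Ty → ℝ) :
    form P (fun r s t => u r * v s * w t) = (∑ r, u r * P r) * (∑ s, v s * P s) * (∑ t, w t * P t) := by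
  unfold form
  symm
  rw [Finset.sum_mul, Finset.sum_mul]
  refine Finset.sum_congr rfl fun r _ => ?_
  simp only [Finset.mul_sum, Finset.sum_mul]
  rw [Finset.sum_comm]
  exact Finset.sum_congr rfl fun s _ => Finset.sum_congr rfl fun t _ => by ring

/-- A coefficient function of `(s, t)` alone gives `σ` times a quadratic form. [folklore] -/
theorem form_of23 (g : Ty → Ty → ℝ) :
    form P (fun _ s t => g s t) = (∑ r, P r) * ∑ s, ∑ t, g s t * (P s * P t) := by
  rw [form, Finset.sum_mul]
  refine Finset.sum_congr rfl fun r _ => ?_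
  rw [Finset.mul_sum]
  refine Finset.sum_congr rfl fun s _ => ?_
  rw [Finset.mul_sum]
  exact Finset.sum_congr rfl fun t _ => by ring

/-! ### Indicators of admissible cell lists -/

/-- `listOK` unpacked. [this work] -/
theorem listOK_iff {L : List ℕ} : listOK L = true ↔ (∀ i ∈ L, i < 15) ∧ L.Nodup := by
  simp [listOK, List.all_eq_true]

/-- **The indicator of an admissible cell list sums the masses over the list.** [this work] -/
theorem sum_ind : ∀ (L : List ℕ), (∀ i ∈ L, i < 15) → L.Nodup → ∑ r, (ind L r : ℝ) * P r = S L P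
  | [], _, _ => by simp [ind, S_nil]
  | i :: L, hlt, hnd => by
    have hi : i < 15 := hlt i List.mem_cons_self
    have hiL : i ∉ L := (List.nodup_cons.1 hnd).1
    have ih := sum_ind L (fun j hj => hlt j (List.mem_cons_of_mem _ hj)) (List.nodup_cons.1 hnd).2
    have hsplit : ∀ r : Ty, (ind (i :: L) r : ℝ) = (if r = tyOf i then 1 else 0) + (ind L r : ℝ) := by
      intro r
      have htyOf : r = tyOf i ↔ r.val = i := by
        constructor
        · intro h; rw [h, tyOf, dif_pos hi]
        · intro h; apply Fin.ext; rw [tyOf, dif_pos hi]; exact h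
      by_cases h : r.val = i
      · simp [ind, h, hiL, htyOf]
      · simp [ind, h, htyOf]
    simp only [hsplit, add_mul, Finset.sum_add_distrib, ih, S_cons, ite_mul, one_mul, zero_mul, Finset.sum_ite_eq',
      Finset.mem_univ, if_true]

/-- `tyOf` on the fifteen literals (for unfolding `S` on literal cell lists by `simp`). [folklore] -/
theorem tyOf_lits : tyOf 0 = (0 : Ty) ∧ tyOf 1 = (1 : Ty) ∧ tyOf 2 = (2 : Ty) ∧ tyOf 3 = (3 : Ty) ∧ tyOf 4 = (4 : Ty) ∧
    tyOf 5 = (5 : Ty) ∧ tyOf 6 = (6 : Ty) ∧ tyOf 7 = (7 : Ty) ∧ tyOf 8 = (8 : Ty) ∧ tyOf 9 = (9 : Ty) ∧ tyOf 10 = (10 : Ty) ∧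
    tyOf 11 = (11 : Ty) ∧ tyOf 12 = (12 : Ty) ∧ tyOf 13 = (13 : Ty) ∧ tyOf 14 = (14 : Ty) := by decide

/-- `σ` as a list sum over all indices. [this work] -/
theorem sum_univ_eq_S : ∑ i, P i = S idxs P := by
  rw [← sum_ind P idxs (fun i hi => lt_of_mem_idxs hi) (by decide)]
  exact Finset.sum_congr rfl fun r _ => by simp [ind, mem_idxs]

/-- `σ` written out (the form in which `FourPointAtoms.sum_cell_eq_one` is stated). [this work] -/
theorem sum_univ_explicit : ∑ i, P i = P 0 + P 1 + P 2 + P 3 + P 4 + P 5 + P 6 + P 7 + P 8 + P 9 + P 10 + P 11 + P 12 +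
    P 13 + P 14 := by
  rw [sum_univ_eq_S]
  simp only [idxs, S_cons, S_nil, tyOf_lits, add_zero]
  ring

/-- The all-ones coefficient sums to `σ`. [folklore] -/
theorem sum_one_mul : ∑ r, (1 : ℝ) * P r = ∑ r, P r := by simp

/-! ### The three parts of the identity -/

/-- The `E₃ʰᵒᵐ` part of the form, for admissible cell lists. [this work] -/
theorem form_e3C {A B C AB AC BC ABC : List ℕ} (hA : listOK A = true) (hB : listOK B = true) (hC : listOK C = true)
    (hAB : listOK AB = true) (hAC : listOK AC = true) (hBC : listOK BC = true) (hABC : listOK ABC = true) :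
    form P (fun r s t => (e3C A B C AB AC BC ABC r s t : ℝ)) =
      2 * S ABC P * (∑ r, P r) * (∑ r, P r) + S A P * S B P * S C P - S A P * S BC P * (∑ r, P r) -
        S B P * S AC P * (∑ r, P r) - S C P * S AB P * (∑ r, P r) := by
  have e : (fun r s t => (e3C A B C AB AC BC ABC r s t : ℝ)) = fun r s t =>
      ((((2 * (ind ABC r : ℝ)) * 1 * 1 + (ind A r : ℝ) * (ind B s : ℝ) * (ind C t : ℝ)) -
        (ind A r : ℝ) * (ind BC s : ℝ) * 1) - (ind B r : ℝ) * (ind AC s : ℝ) * 1) - (ind C r : ℝ) * (ind AB s : ℝ) * 1 := by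
    funext r s t; simp only [e3C]; push_cast; ring
  rw [e, form_sub, form_sub, form_sub, form_add, form_prod, form_prod, form_prod, form_prod, form_prod]
  obtain ⟨hA1, hA2⟩ := listOK_iff.1 hA; obtain ⟨hB1, hB2⟩ := listOK_iff.1 hB; obtain ⟨hC1, hC2⟩ := listOK_iff.1 hC
  obtain ⟨hAB1, hAB2⟩ := listOK_iff.1 hAB; obtain ⟨hAC1, hAC2⟩ := listOK_iff.1 hAC
  obtain ⟨hBC1, hBC2⟩ := listOK_iff.1 hBC; obtain ⟨hABC1, hABC2⟩ := listOK_iff.1 hABC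
  have h2 : ∑ r, 2 * (ind ABC r : ℝ) * P r = 2 * S ABC P := by
    rw [← sum_ind P ABC hABC1 hABC2, Finset.mul_sum]; exact Finset.sum_congr rfl fun r _ => by ring
  rw [h2, sum_ind P A hA1 hA2, sum_ind P B hB1 hB2, sum_ind P C hC1 hC2, sum_ind P AB hAB1 hAB2, sum_ind P AC hAC1 hAC2,
    sum_ind P BC hBC1 hBC2, sum_one_mul]

/-- The program part of `ES` is the quadratic form of `lpC` (tables tabulate the potentials). [this work] -/
theorem esProgs_eq_lpC : ∀ (qs : List Prog) (TP : List (List (List ℤ))), List.Forall₂ (fun p T => TabOK p.lam T) qs TP →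
    esProgs P qs = ∑ s, ∑ t, (lpC TP s t : ℝ) * (P s * P t)
  | [], _, List.Forall₂.nil => by simp [esProgs, lpC]
  | p :: qs, T :: TP, List.Forall₂.cons hT hTP => by
    rw [esProgs, esProgs_eq_lpC qs TP hTP, ← Finset.sum_add_distrib]
    refine Finset.sum_congr rfl fun s _ => ?_
    rw [← Finset.sum_add_distrib]
    refine Finset.sum_congr rfl fun t _ => ?_
    simp only [lpC, List.map_cons, List.sum_cons, hT s t]
    push_cast; ring

end Sums

/-! ### Soundness of the cubic check -/

/-- **From the cubic check, `Σ P = 1` and `ES ≤ 0` to `E₃ ≥ 0` at the level of cells.** [this work] -/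
theorem cubic_sound (c : Cert) {T03 : List (List (List ℤ))} {TP : List (List (List ℤ))}
    (hT0 : ∀ πX : Ty, TabOK (c.lam0 πX) (getN T03 πX.val [])) (hTP : List.Forall₂ (fun p T => TabOK p.lam T) c.progs TP)
    {D : ℤ} {A B C AB AC BC ABC : List ℕ} (hchk : cubicCheck T03 TP D A B C AB AC BC ABC = true)
    (P : Ty → ℝ) (hσ : ∑ i, P i = 1) (hES : ES c P ≤ 0) :
    0 ≤ 2 * S ABC P + S A P * S B P * S C P - (S A P * S BC P + S B P * S AC P + S C P * S AB P) := by
  simp only [cubicCheck, Bool.and_eq_true, decide_eq_true_iff, List.all_eq_true, beq_iff_eq] at hchk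
  obtain ⟨⟨⟨⟨⟨⟨⟨⟨hD, hA⟩, hB⟩, hC⟩, hAB⟩, hAC⟩, hBC⟩, hABC⟩, hsym⟩ := hchk
  -- the form of the integer coefficient function vanishes
  have hform : form P (fun r s t => (coefZ T03 TP D A B C AB AC BC ABC r s t : ℝ)) = 0 :=
    form_eq_zero_of_symC P _ fun r s t => hsym r (mem_allTys r) s (mem_allTys s) t (mem_allTys t)
  -- and it splits into `λ₀`-part + `σ`·program part + `D`·`E₃ʰᵒᵐ`
  have hsplit : form P (fun r s t => (coefZ T03 TP D A B C AB AC BC ABC r s t : ℝ)) =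
      (∑ r, ∑ s, ∑ t, (c.lam0 r s t : ℝ) * (P r * P s * P t)) + (∑ r, P r) * (∑ s, ∑ t, (lpC TP s t : ℝ) * (P s * P t)) +
        (D : ℝ) * form P (fun r s t => (e3C A B C AB AC BC ABC r s t : ℝ)) := by
    have e : (fun r s t => (coefZ T03 TP D A B C AB AC BC ABC r s t : ℝ)) = fun r s t =>
        ((c.lam0 r s t : ℝ) + (lpC TP s t : ℝ)) + (D : ℝ) * (e3C A B C AB AC BC ABC r s t : ℝ) := by
      funext r s t; simp only [coefZ, hT0 r s t]; push_cast; ring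
    rw [e, form_add, form_add, form_smul, form_of23]; rfl
  rw [hsplit, form_e3C P hA hB hC hAB hAC hBC hABC, hσ] at hform
  simp only [mul_one, one_mul] at hform
  rw [ES, esProgs_eq_lpC P c.progs TP hTP] at hES
  have hDpos : (0 : ℝ) < D := by exact_mod_cast hD
  have key : (D : ℝ) * (2 * S ABC P + S A P * S B P * S C P - (S A P * S BC P + S B P * S AC P + S C P * S AB P)) =
      -((∑ r, ∑ s, ∑ t, (c.lam0 r s t : ℝ) * (P r * P s * P t)) + ∑ s, ∑ t, (lpC TP s t : ℝ) * (P s * P t)) := by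
    linarith
  have : 0 ≤ (D : ℝ) * (2 * S ABC P + S A P * S B P * S C P - (S A P * S BC P + S B P * S AC P + S C P * S AB P)) := by
    rw [key]; linarith
  exact le_of_mul_le_mul_left (by linarith [this]) hDpos

end SwitchRelax

end Summit.CriticalPhenomena.PercolationContinuityZ3.Theorems
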